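import Mathlib
import HarnessLib

/-!
# The Grad–Shafranov equation and the axisymmetric ideal-MHD equilibrium objects (as printed)

Typed AS PRINTED from J. P. Freidberg, *Ideal MHD* (Cambridge University Press, 2014) —
bib key `Freidberg2014` — Chapter 6, with the locators read on the page by the typer
(LADDER-GRIDFUSION cell, seat gridfusion-model-5, 2026-08-26; galaxy panama:388488381857833):

* stream function and poloidal field `B_R = -(1/R) ∂ψ/∂Z`, `B_Z = (1/R) ∂ψ/∂R` — §6.2.1 eq. (6.2), p.125;
* the operator `Δ* ψ ≡ R ∂/∂R((1/R) ∂ψ/∂R) + ∂²ψ/∂Z²` — §6.2.2 eq. (6.7), p.126, and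
  `μ₀ J_φ = -(1/R) Δ*ψ` — eq. (6.6);
* the free function `F(ψ) = R B_φ` — eq. (6.11), p.127;
* the Grad–Shafranov equation `Δ*ψ = -μ₀ R² dp/dψ - ½ dF²/dψ` — eq. (6.15), p.128
  (also Pataki–Cerfon–Freidberg, J. Comput. Phys. 243 (2013) §2.1 — bib key `PatakiCerfonFreidberg2013`);
* Solov'ev profiles `F dF/dψ = -A`, `μ₀ dp/dψ = -C`, giving `Δ*ψ = A + C R²` — §6.6.1 eq. (6.149), p.177,
  and the normalised form `X ∂_X (X⁻¹ ∂_X U) + ∂_Y² U = α + (1-α) X²` — eq. (6.150), p.178;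
* volume derivative `dV/dψ = 2π ∮ dl/B_p` (6.22), toroidal beta (6.24), poloidal beta (6.26),
  toroidal current `μ₀ I = ∮ B_p dl` (6.27), kink safety factor `q_*` (6.29), the MHD safety factor
  `q(ψ) = F(ψ)/(2π) ∮ dl/(R² B_p)` (6.35), pp.130–132, and its on-axis value
  `q₀ = F/(R_a (ψ_RR ψ_ZZ)^{1/2}) = B_φ/(ψ_RR ψ_ZZ)^{1/2}` — §6.3.6 eqs. (6.41)–(6.42), p.134.

HONEST FRAMING (LADDER-GRIDFUSION three columns): these are the MODEL objects «ideal MHD, toroidally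
axisymmetric, static equilibrium»; nothing here says any configuration is stable.

Design choices. Functions of `(R, Z)` are curried `ψ : ℝ → ℝ → ℝ`; partial derivatives are Mathlib's
one-variable `deriv` / `iteratedDeriv 2` in each slot (the tree's convention for 1+1 / 2-D PDE items,
cf. `Literature/Analysis/PDE/DAlembert1D.lean`). `Δ*` is typed LITERALLY in the nested form of (6.7)
(`gsOperator`); the expanded form `ψ_RR - ψ_R/R + ψ_ZZ` is a proved lemma under differentiability at
`R ≠ 0`. Contour functionals (`∮ … dl`) are typed for an explicitly supplied parametrisation of the
flux surface (`loopIntegral`); that the parametrisation traces the surface once is the user's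
hypothesis (`IsFluxSurfaceLoop`). No `instance`, no `notation`.
What is NOT here: existence/regularity theory; flux coordinates; the energy principle and the
stability criteria (other files of this directory); exact solutions (`SolovevSolutions.lean`).
-/

noncomputable section

namespace Literature.MathematicalPhysics.MHD.GradShafranov

open _root_.Real _root_.MeasureTheory _root_.intervalIntegral

/-! ## Partial derivatives of a curried function `ψ : ℝ → ℝ → ℝ` of `(R, Z)` -/

/-- `∂ψ/∂R` at `(R, Z)` (Mathlib `deriv` in the first slot). [folklore] -/
def dR (ψ : ℝ → ℝ → ℝ) (R Z : ℝ) : ℝ := deriv (fun r => ψ r Z) R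

/-- `∂ψ/∂Z` at `(R, Z)` (Mathlib `deriv` in the second slot). [folklore] -/
def dZ (ψ : ℝ → ℝ → ℝ) (R Z : ℝ) : ℝ := deriv (ψ R) Z

/-- `∂²ψ/∂R²` at `(R, Z)` (`iteratedDeriv 2` in the first slot). [folklore] -/
def dRR (ψ : ℝ → ℝ → ℝ) (R Z : ℝ) : ℝ := iteratedDeriv 2 (fun r => ψ r Z) R

/-- `∂²ψ/∂Z²` at `(R, Z)` (`iteratedDeriv 2` in the second slot). [folklore] -/
def dZZ (ψ : ℝ → ℝ → ℝ) (R Z : ℝ) : ℝ := iteratedDeriv 2 (ψ R) Z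

/-! ## The operator `Δ*`, the fields and the toroidal current density -/

/-- The Grad–Shafranov operator AS PRINTED (Freidberg eq. (6.7), p.126):
`Δ*ψ ≡ R ∂/∂R ( (1/R) ∂ψ/∂R ) + ∂²ψ/∂Z²` (nested one-variable derivatives in `R`).
[cite: Freidberg2014, §6.2.2 eq. (6.7)] -/
def gsOperator (ψ : ℝ → ℝ → ℝ) (R Z : ℝ) : ℝ :=
  R * deriv (fun r => r⁻¹ * dR ψ r Z) R + dZZ ψ R Z

/-- Radial poloidal field component `B_R = -(1/R) ∂ψ/∂Z`. [cite: Freidberg2014, §6.2.1 eq. (6.2)] -/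
def fieldBR (ψ : ℝ → ℝ → ℝ) (R Z : ℝ) : ℝ := -(R⁻¹ * dZ ψ R Z)

/-- Vertical poloidal field component `B_Z = (1/R) ∂ψ/∂R`. [cite: Freidberg2014, §6.2.1 eq. (6.2)] -/
def fieldBZ (ψ : ℝ → ℝ → ℝ) (R Z : ℝ) : ℝ := R⁻¹ * dR ψ R Z

/-- Poloidal field magnitude `B_p = |B_p| = (B_R² + B_Z²)^{1/2}` (`= |∇ψ|/R`). [cite: Freidberg2014, §6.2.1 eq. (6.3)] -/
def fieldBpol (ψ : ℝ → ℝ → ℝ) (R Z : ℝ) : ℝ := Real.sqrt (fieldBR ψ R Z ^ 2 + fieldBZ ψ R Z ^ 2)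

/-- Toroidal field `B_φ = F(ψ)/R` from the free function `F(ψ) = R B_φ`. [cite: Freidberg2014, §6.2.3 eq. (6.11)] -/
def fieldBphi (F : ℝ → ℝ) (ψ : ℝ → ℝ → ℝ) (R Z : ℝ) : ℝ := F (ψ R Z) / R

/-- Total field magnitude squared `B² = B_φ² + B_p²` from `B = B_φ e_φ + B_p`. [cite: Freidberg2014, §6.2.1 eq. (6.3)] -/
def fieldBsq (F : ℝ → ℝ) (ψ : ℝ → ℝ → ℝ) (R Z : ℝ) : ℝ :=
  fieldBphi F ψ R Z ^ 2 + (fieldBR ψ R Z ^ 2 + fieldBZ ψ R Z ^ 2)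

/-- `μ₀ J_φ = -(1/R) Δ*ψ`, the toroidal current density (times `μ₀`). [cite: Freidberg2014, §6.2.2 eq. (6.6)] -/
def muJphi (ψ : ℝ → ℝ → ℝ) (R Z : ℝ) : ℝ := -(R⁻¹ * gsOperator ψ R Z)

/-! ## The Grad–Shafranov equation and the Solov'ev profiles -/

/-- The right-hand side of the Grad–Shafranov equation for free functions `p` (pressure) and `F`,
`-μ₀ R² dp/dψ - ½ dF²/dψ`, evaluated at flux value `s` and radius `R`. [cite: Freidberg2014, §6.2.3 eq. (6.15)] -/
def gsRHS (μ0 : ℝ) (p F : ℝ → ℝ) (R s : ℝ) : ℝ :=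
  -(μ0 * R ^ 2 * deriv p s) - (1 / 2) * deriv (fun t => F t ^ 2) s

/-- `ψ` solves the Grad–Shafranov equation `Δ*ψ = -μ₀ R² p'(ψ) - ½ (F²)'(ψ)` (Freidberg eq. (6.15),
p.128; PCF2013 §2.1) at every point of the region `Ω ⊆ {(R, Z)}` (typically the plasma cross-section,
`R > 0`). Regularity of `ψ, p, F` is NOT part of this predicate — it is the user's hypothesis.
[cite: Freidberg2014, §6.2.3 eq. (6.15)] -/
def IsGSSolutionOn (Ω : Set (ℝ × ℝ)) (ψ : ℝ → ℝ → ℝ) (μ0 : ℝ) (p F : ℝ → ℝ) : Prop :=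
  ∀ R Z, (R, Z) ∈ Ω → gsOperator ψ R Z = gsRHS μ0 p F R (ψ R Z)

/-- Solov'ev profiles (Freidberg §6.6.1, text above eq. (6.149)): `F dF/dψ = -A` and `μ₀ dp/dψ = -C` for
constants `A, C` (both free functions linear in `ψ` through `F²` and `p`), with `F` differentiable.
[cite: Freidberg2014, §6.6.1 eq. (6.149)] -/
def IsSolovevProfile (μ0 : ℝ) (p F : ℝ → ℝ) (A C : ℝ) : Prop :=
  ∀ s, DifferentiableAt ℝ F s ∧ F s * deriv F s = -A ∧ μ0 * deriv p s = -C

/-- The Solov'ev form of the Grad–Shafranov equation: `Δ*ψ = A + C R²` on `Ω`. [cite: Freidberg2014, §6.6.1 eq. (6.149)] -/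
def IsSolovevSolutionOn (Ω : Set (ℝ × ℝ)) (ψ : ℝ → ℝ → ℝ) (A C : ℝ) : Prop :=
  ∀ R Z, (R, Z) ∈ Ω → gsOperator ψ R Z = A + C * R ^ 2

/-- The normalised Solov'ev/Cerfon–Freidberg equation (Freidberg eq. (6.150)): in `X = R/R₀`, `Y = Z/R₀`,
`U = ψ/ψ₀` with `ψ₀ = R₀²(A + C R₀²)` and `α = A/(A + C R₀²)`,
`X ∂_X (X⁻¹ ∂_X U) + ∂_Y² U = α + (1 - α) X²` on `Ω`. (Same operator `Δ*` in the variables `X, Y`.)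
[cite: Freidberg2014, §6.6.1 eq. (6.150)] -/
def IsNormalisedSolovevSolutionOn (Ω : Set (ℝ × ℝ)) (U : ℝ → ℝ → ℝ) (α : ℝ) : Prop :=
  ∀ X Y, (X, Y) ∈ Ω → gsOperator U X Y = α + (1 - α) * X ^ 2

/-- Under Solov'ev profiles the Grad–Shafranov right-hand side is the constant-coefficient
`A + C R²`. [cite: Freidberg2014, §6.6.1 eq. (6.149)] -/
theorem gsRHS_of_solovev {μ0 A C : ℝ} {p F : ℝ → ℝ} (h : IsSolovevProfile μ0 p F A C)
    (R s : ℝ) : gsRHS μ0 p F R s = A + C * R ^ 2 := by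
  obtain ⟨hF, hFF, hp⟩ := h s
  have h2' : HasDerivAt (fun t => F t ^ 2) (((2 : ℕ) : ℝ) * F s ^ (2 - 1) * deriv F s) s :=
    hF.hasDerivAt.pow 2
  have h2 : deriv (fun t => F t ^ 2) s = 2 * F s * deriv F s := by
    rw [h2'.deriv]; norm_num
  unfold gsRHS
  rw [h2]
  have hp' : μ0 * R ^ 2 * deriv p s = -(C * R ^ 2) := by
    calc μ0 * R ^ 2 * deriv p s = (μ0 * deriv p s) * R ^ 2 := by ring
      _ = -(C * R ^ 2) := by rw [hp]; ring
  rw [hp']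
  linear_combination (-1 : ℝ) * hFF

/-- Hence, with Solov'ev profiles, «`ψ` solves the Grad–Shafranov equation on `Ω`» is the same as
«`Δ*ψ = A + C R²` on `Ω`». [cite: Freidberg2014, §6.6.1 eq. (6.149)] -/
theorem isGSSolutionOn_iff_solovev {Ω : Set (ℝ × ℝ)} {ψ : ℝ → ℝ → ℝ} {μ0 A C : ℝ} {p F : ℝ → ℝ}
    (h : IsSolovevProfile μ0 p F A C) :
    IsGSSolutionOn Ω ψ μ0 p F ↔ IsSolovevSolutionOn Ω ψ A C := by
  unfold IsGSSolutionOn IsSolovevSolutionOn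
  simp only [gsRHS_of_solovev h]

/-- Expanded form of `Δ*`: if `r ↦ ∂ψ/∂R (r, Z)` is differentiable at `R ≠ 0` then
`Δ*ψ = ∂²ψ/∂R² - (1/R) ∂ψ/∂R + ∂²ψ/∂Z²` (the form printed in PCF2013 §3.1).
[cite: PatakiCerfonFreidberg2013, §3.1] -/
theorem gsOperator_eq_expanded {ψ : ℝ → ℝ → ℝ} {R Z : ℝ} (hR : R ≠ 0)
    (hd : DifferentiableAt ℝ (fun r => dR ψ r Z) R) :
    gsOperator ψ R Z = dRR ψ R Z - R⁻¹ * dR ψ R Z + dZZ ψ R Z := by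
  unfold gsOperator dRR
  have hinv : HasDerivAt (fun r : ℝ => r⁻¹) (-(R ^ 2)⁻¹) R := hasDerivAt_inv hR
  have hprod : HasDerivAt (fun r : ℝ => r⁻¹ * dR ψ r Z)
      (-(R ^ 2)⁻¹ * dR ψ R Z + R⁻¹ * deriv (fun r => dR ψ r Z) R) R :=
    hinv.mul hd.hasDerivAt
  rw [hprod.deriv, show (2 : ℕ) = 1 + 1 from rfl, iteratedDeriv_succ, iteratedDeriv_one]
  have : deriv (fun r => dR ψ r Z) R = deriv (deriv fun r => ψ r Z) R := rfl
  rw [this]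
  field_simp
  ring

/-! ## Magnetic axis, figures of merit, safety factor -/

/-- `(R_a, Z_a)` is a critical point of `ψ` (`∇ψ = 0`): the defining property of the magnetic axis,
Freidberg §6.3.6, p.133 («the first derivatives of ψ vanish on the axis»). Non-degeneracy / extremality is
a separate hypothesis where needed. [cite: Freidberg2014, §6.3.6] -/
def IsCriticalPoint (ψ : ℝ → ℝ → ℝ) (Ra Za : ℝ) : Prop := dR ψ Ra Za = 0 ∧ dZ ψ Ra Za = 0

/-- On-axis safety factor AS PRINTED, Freidberg eq. (6.41)/(6.42), p.134:
`q₀ = F(ψ_axis) / (R_a (ψ_RR ψ_ZZ)^{1/2}) = B_φ(axis)/(ψ_RR ψ_ZZ)^{1/2}`, a function of the on-axis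
data (`Fa = F(ψ_axis)`, `Ra`, and the second derivatives at the axis). The book derives it as the
`ψ → 0` limit of (6.35) for the locally elliptical surfaces (6.36); that limit statement is not
re-proved here. [cite: Freidberg2014, §6.3.6 eq. (6.42)] -/
def safetyFactorOnAxis (Fa Ra ψRR ψZZ : ℝ) : ℝ := Fa / (Ra * Real.sqrt (ψRR * ψZZ))

/-- On-axis elongation `κ₀` from `ψ_RR/ψ_ZZ = κ₀²` (text after eq. (6.42), p.134). [cite: Freidberg2014, §6.3.6 eq. (6.42)] -/
def elongationOnAxis (ψRR ψZZ : ℝ) : ℝ := Real.sqrt (ψRR / ψZZ)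

/-- The square of the on-axis safety factor is the RATIONAL expression `Fa²/(Ra² ψ_RR ψ_ZZ)`
whenever `ψ_RR ψ_ZZ ≥ 0` (so no square root survives): the form used by exact certificates.
[cite: Freidberg2014, §6.3.6 eq. (6.42)] -/
theorem safetyFactorOnAxis_sq {Fa Ra ψRR ψZZ : ℝ} (h : 0 ≤ ψRR * ψZZ) :
    safetyFactorOnAxis Fa Ra ψRR ψZZ ^ 2 = Fa ^ 2 / (Ra ^ 2 * (ψRR * ψZZ)) := by
  unfold safetyFactorOnAxis
  rw [div_pow, mul_pow, Real.sq_sqrt h]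

/-- Kink safety factor AS PRINTED (eq. (6.29), p.131):
`q_* = (2π a² B₀ /(μ₀ R₀ I)) · (1 + κ²)/2` (minor radius `a`, vacuum field `B₀` at `R₀`, toroidal
current `I`, elongation `κ`). [cite: Freidberg2014, §6.3.4 eq. (6.29)] -/
def kinkSafetyFactor (μ0 a B0 R0 I κ : ℝ) : ℝ :=
  2 * π * a ^ 2 * B0 / (μ0 * R0 * I) * ((1 + κ ^ 2) / 2)

/-- Toroidal beta AS PRINTED (eq. (6.24), p.130): `β_t = 2 μ₀ ⟨p⟩ / B₀²`. [cite: Freidberg2014, §6.3.3 eq. (6.24)] -/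
def betaToroidal (μ0 pavg B0 : ℝ) : ℝ := 2 * μ0 * pavg / B0 ^ 2

/-- Poloidal beta AS PRINTED (eq. (6.26), p.131): `β_p = 4π² a² (1+κ²) ⟨p⟩ / (μ₀ I²)`. [cite: Freidberg2014, §6.3.3 eq. (6.26)] -/
def betaPoloidal (μ0 a κ pavg I : ℝ) : ℝ := 4 * π ^ 2 * a ^ 2 * (1 + κ ^ 2) * pavg / (μ0 * I ^ 2)

/-- Line integral `∫_0^T g(γ(t)) |γ'(t)| dt` of a scalar `g(R, Z)` along a parametrised curve
`γ : [0, T] → (R, Z)`-plane (the `∮ g dl` of Freidberg §6.3 when `γ` traces a closed flux surface once).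
[folklore] -/
def loopIntegral (γ : ℝ → ℝ × ℝ) (T : ℝ) (g : ℝ → ℝ → ℝ) : ℝ :=
  ∫ t in (0 : ℝ)..T, g (γ t).1 (γ t).2 * ‖deriv γ t‖

/-- `γ : [0, T] → Ω` traces the flux surface `{ψ = c} ∩ Ω` exactly once: `γ` is differentiable,
closed (`γ 0 = γ T`), injective on `[0, T)`, lies on the level set, and covers all of it. This is the
HYPOTHESIS under which `loopIntegral γ T g` is the book's `∮ g dl` over the surface `ψ = c` (the
`(ψ, l)` flux-coordinate picture of §6.3.1, arc length `l` replaced by any parameter `t`).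
[cite: Freidberg2014, §6.3.1 eq. (6.17)] -/
def IsFluxSurfaceLoop (Ω : Set (ℝ × ℝ)) (ψ : ℝ → ℝ → ℝ) (c : ℝ) (γ : ℝ → ℝ × ℝ) (T : ℝ) : Prop :=
  0 < T ∧ Differentiable ℝ γ ∧ γ 0 = γ T ∧ Set.InjOn γ (Set.Ico 0 T) ∧
    γ '' Set.Icc 0 T = {x ∈ Ω | ψ x.1 x.2 = c}

/-- Toroidal current inside a flux surface AS PRINTED (eq. (6.27), p.131): `μ₀ I = ∮ B_p dl`
(returned here as `I`, i.e. divided by `μ₀`), for a supplied parametrisation `γ` of the surface.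
[cite: Freidberg2014, §6.3.3 eq. (6.27)] -/
def toroidalCurrent (μ0 : ℝ) (ψ : ℝ → ℝ → ℝ) (γ : ℝ → ℝ × ℝ) (T : ℝ) : ℝ :=
  loopIntegral γ T (fieldBpol ψ) / μ0

/-- The MHD safety factor AS PRINTED (eq. (6.35), p.132):
`q(ψ) = (F(ψ)/2π) ∮ dl/(R² B_p)`, the contour being the flux surface `ψ = c` traced by `γ`
(`Fc = F(c)` is the value of the free function on that surface). [cite: Freidberg2014, §6.3.5 eq. (6.35)] -/
def safetyFactor (Fc : ℝ) (ψ : ℝ → ℝ → ℝ) (γ : ℝ → ℝ × ℝ) (T : ℝ) : ℝ :=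
  Fc / (2 * π) * loopIntegral γ T (fun R Z => 1 / (R ^ 2 * fieldBpol ψ R Z))

/-- Flux-surface volume derivative AS PRINTED (eq. (6.22), p.130): `dV/dψ = 2π ∮ dl/B_p`. [cite: Freidberg2014, §6.3.2 eq. (6.22)] -/
def volumeDeriv (ψ : ℝ → ℝ → ℝ) (γ : ℝ → ℝ × ℝ) (T : ℝ) : ℝ :=
  2 * π * loopIntegral γ T (fun R Z => 1 / fieldBpol ψ R Z)

end Literature.MathematicalPhysics.MHD.GradShafranov

namespace Literature.MathematicalPhysics.MHD.GradShafranov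

open _root_.Real _root_.MeasureTheory _root_.intervalIntegral

/-! ## Euclidean-speed contour functionals (append 2026-08-26, LADDER-GRIDFUSION RULING 15)

DEFECT RECORD (found by gridfusion-sos-6, confirmed by ref-2, 2026-08-26T19:09Z/19:16Z): for
`γ : ℝ → ℝ × ℝ` Mathlib's `‖deriv γ t‖` is the PRODUCT norm `max (|R′(t)|) (|Z′(t)|)` (`Prod.toNorm`),
not the Euclidean speed. Hence `loopIntegral`, `toroidalCurrent`, `safetyFactor`, `volumeDeriv` above
integrate `g · max(|R′|,|Z′|) dt` and are NOT the book's `∮ g dl` (they agree only where `R′Z′ = 0`).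
They are kept unchanged (append-only tree) and are SUPERSEDED by the `…E` variants below, which use the
Euclidean speed `√(R′² + Z′²)` computed from the componentwise derivatives. Cite the `…E` names for
(6.22)/(6.27)/(6.35) from now on. -/

/-- Euclidean speed `|γ′(t)| = √(R′(t)² + Z′(t)²)` of a parametrised poloidal curve `γ = (R, Z)`
(componentwise one-variable derivatives). [folklore] -/
def speed (γ : ℝ → ℝ × ℝ) (t : ℝ) : ℝ :=
  Real.sqrt (deriv (fun s => (γ s).1) t ^ 2 + deriv (fun s => (γ s).2) t ^ 2)

/-- Line integral with EUCLIDEAN arc length, `∫_0^T g(γ(t)) |γ′(t)| dt` = the book's `∮ g dl` when `γ`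
traces the flux surface once (`IsFluxSurfaceLoop`). Supersedes `loopIntegral` (sup-norm variant).
[cite: Freidberg2014, §6.3.1 eq. (6.17)] -/
def loopIntegralE (γ : ℝ → ℝ × ℝ) (T : ℝ) (g : ℝ → ℝ → ℝ) : ℝ :=
  ∫ t in (0 : ℝ)..T, g (γ t).1 (γ t).2 * speed γ t

/-- Toroidal current AS PRINTED (6.27), `μ₀ I = ∮ B_p dl` (returned as `I`), Euclidean arc length.
Supersedes `toroidalCurrent`. [cite: Freidberg2014, §6.3.3 eq. (6.27)] -/
def toroidalCurrentE (μ0 : ℝ) (ψ : ℝ → ℝ → ℝ) (γ : ℝ → ℝ × ℝ) (T : ℝ) : ℝ :=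
  loopIntegralE γ T (fieldBpol ψ) / μ0

/-- The MHD safety factor AS PRINTED (6.35), `q(ψ) = (F(ψ)/2π) ∮ dl/(R² B_p)`, Euclidean arc length over the
flux surface `ψ = c` traced by `γ` (`Fc = F(c)`). Supersedes `safetyFactor`. [cite: Freidberg2014, §6.3.5 eq. (6.35)] -/
def safetyFactorE (Fc : ℝ) (ψ : ℝ → ℝ → ℝ) (γ : ℝ → ℝ × ℝ) (T : ℝ) : ℝ :=
  Fc / (2 * π) * loopIntegralE γ T (fun R Z => 1 / (R ^ 2 * fieldBpol ψ R Z))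

/-- Flux-surface volume derivative AS PRINTED (6.22), `dV/dψ = 2π ∮ dl/B_p`, Euclidean arc length.
Supersedes `volumeDeriv`. [cite: Freidberg2014, §6.3.2 eq. (6.22)] -/
def volumeDerivE (ψ : ℝ → ℝ → ℝ) (γ : ℝ → ℝ × ℝ) (T : ℝ) : ℝ :=
  2 * π * loopIntegralE γ T (fun R Z => 1 / fieldBpol ψ R Z)

end Literature.MathematicalPhysics.MHD.GradShafranov
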